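import Literature.Analysis.FluidPDE.BesovDivergenceForm
import Literature.Analysis.FluidPDE.CriticalSpacesBMOBesovProofs
import Literature.Analysis.FluidPDE.LeraySeparationOfEnergyTools
import Literature.Analysis.FunctionSpaces.BesovPairing
import HarnessLib

/-!
# The local `L³` estimate of a smooth field through its critical Besov norm
# (Wang–Zhang 2017, Lemma 4.1, first display — slice form)

Analysis/FluidPDE proof file (theorems only: no definition, no named fact). The analytic heart of
W. Wang, Z. Zhang, *Blow-up of critical norms for the 3-D Navier–Stokes equations*, Sci. China
Math. 60 (2017) = arXiv:1510.02589, **Lemma 4.1**: for a smooth solution bounded in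
`L^∞_t BMO^{-1}` one writes `u_i = ∂_j U^j_i` and integrates by parts,
"`r⁻² ∫_{Q_{2r}} |u_i|³ ζ² = r⁻² ∫ ∑_j ∂_j U^j_i u_i |u| ζ² ≤ C r⁻² ∫ |U - U_{B_{2r}}| (|∇u||u| + |u|²|∇ζ|)`",
whence by Hölder `C(u,r) ≤ C(M)(E(u,2r)^{1/2} C(u,2r)^{1/3} + C(u,2r)^{2/3})`.

This file proves the **slice** (fixed-time) form of that estimate for a smooth field
`f : ℝ³ → ℝ³` represented by a tempered distribution `U` with `‖U‖_{Ḃ^{-1+3/p}_{p,∞}} ≤ M`,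
`6 ≤ p < ∞`, in the `BMO`-free rendering available in the tree: the splitting
`U = Ṡ_N U + ∑_k ∂_k V_k` with `‖Ṡ_N U‖_{L^∞} ≲ 2^N M`
(`FunctionSpaces.eLpNormDistrib_lowFreqCutoff_le_of_neg` and the Besov embedding into
`Ḃ^{-1}_{∞,∞}`) and `‖V_k‖_{L^p} ≲ 2^{-3N/p} M` (`exists_sub_lowFreqCutoff_eq_sum_lineDeriv_of_eHomBesovNorm`).
Tested against the smooth compactly supported fields `g_ε = ⟨f⟩_ε ζ² f`, `⟨f⟩_ε = √(|f|² + ε²)`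
(the regularisation of `|f| f ζ²`, whose derivatives obey
`|∂_k (g_ε)_i| ≤ 2 |∇f| ⟨f⟩_ε ζ² + 2 L ⟨f⟩_ε |f| ζ` when `|∇ζ| ≤ L`), the pairing identity
`∫ |f|² ⟨f⟩_ε ζ² = ∑_i Re ⟨U, (g_ε)_i⟩` and Hölder's inequality on the ball carrying `ζ` give,
after `ε → 0`,

`∫ |f|³ ζ² ≤ K M (2^N ∫_B |f|² + 2^{-3N/p} |B|^{1/6-1/p} ‖∇f‖_{L²(B)} ‖f‖_{L³(B)}`
`                 + 2^{-3N/p} L |B|^{1/3-1/p} ‖f‖²_{L³(B)})`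

(`exists_lintegral_cube_mul_sq_le_of_eHomBesovNorm_le`) with `K` depending only on `p`. The
time-integrated form (the display of Lemma 4.1) and its iteration are carried out separately.

## References

* W. Wang, Z. Zhang, Sci. China Math. 60 (2017) 637–650 = arXiv:1510.02589, Lemma 4.1.
  [WangZhang2016]
* H. Koch, D. Tataru, Adv. Math. 157 (2001) 22–35, Thm. 1. [KochTataru2001]
* H. Bahouri, J.-Y. Chemin, R. Danchin, *Fourier Analysis and Nonlinear PDE* (2011), Lemma 2.1,
  Prop. 2.20. [BahouriCheminDanchin2011]
-/

noncomputable section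

open MeasureTheory TemperedDistribution Filter Set Function Metric
open _root_.Topology
open scoped SchwartzMap ENNReal NNReal LineDeriv InnerProductSpace RealInnerProductSpace

namespace Literature.Analysis.FluidPDE

open FunctionSpaces.EuclideanSpace (complexify)

/-! ## The regularised modulus `⟨f⟩_ε = √(|f|² + ε²)` and the test fields `⟨f⟩_ε ζ² f_i` -/

section Regularised

variable {E : Type*} [NormedAddCommGroup E] [NormedSpace ℝ E]
  {F' : Type*} [NormedAddCommGroup F'] [InnerProductSpace ℝ F']

/-- `⟨f⟩_ε = √(‖f‖² + ε²)` is smooth when `f` is and `ε ≠ 0`. [folklore] -/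
theorem contDiff_sqrt_norm_sq_add_sq {n : WithTop ℕ∞} {f : E → F'} (hf : ContDiff ℝ n f)
    {ε : ℝ} (hε : ε ≠ 0) :
    ContDiff ℝ n fun x => Real.sqrt (‖f x‖ ^ 2 + ε ^ 2) := by
  refine ContDiff.sqrt ((hf.norm_sq ℝ).add contDiff_const) fun x => ?_
  have : 0 < ‖f x‖ ^ 2 + ε ^ 2 := by positivity
  exact this.ne'

/-- `‖f‖ ≤ ⟨f⟩_ε`. [folklore] -/
theorem norm_le_sqrt_norm_sq_add_sq {F'' : Type*} [NormedAddCommGroup F''] (v : F'') (ε : ℝ) :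
    ‖v‖ ≤ Real.sqrt (‖v‖ ^ 2 + ε ^ 2) :=
  calc ‖v‖ = Real.sqrt (‖v‖ ^ 2) := (Real.sqrt_sq (norm_nonneg v)).symm
    _ ≤ Real.sqrt (‖v‖ ^ 2 + ε ^ 2) := Real.sqrt_le_sqrt (by nlinarith [sq_nonneg ε])

/-- `⟨f⟩_ε ≤ ‖f‖ + ε` for `ε ≥ 0`. [folklore] -/
theorem sqrt_norm_sq_add_sq_le {F'' : Type*} [NormedAddCommGroup F''] (v : F'') {ε : ℝ}
    (hε : 0 ≤ ε) :
    Real.sqrt (‖v‖ ^ 2 + ε ^ 2) ≤ ‖v‖ + ε := by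
  rw [Real.sqrt_le_left (by positivity)]
  nlinarith [norm_nonneg v]

/-- **The derivative of `⟨f⟩_ε` is bounded by `|∇f|`**: `|∂_v ⟨f⟩_ε| ≤ ‖Df v‖`
(`∂_v ⟨f⟩_ε = ⟪f, Df v⟫ / ⟨f⟩_ε` and `‖f‖ ≤ ⟨f⟩_ε`). [folklore] -/
theorem hasFDerivAt_sqrt_norm_sq_add_sq {f : E → F'} {f' : E →L[ℝ] F'} {x : E}
    (hf : HasFDerivAt f f' x) {ε : ℝ} (hε : 0 < ε) :
    ∃ D : E →L[ℝ] ℝ, HasFDerivAt (fun x => Real.sqrt (‖f x‖ ^ 2 + ε ^ 2)) D x ∧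
      ∀ v, ‖D v‖ ≤ ‖f' v‖ := by
  have hpos : 0 < ‖f x‖ ^ 2 + ε ^ 2 := by positivity
  have h1 : HasFDerivAt (fun x => ‖f x‖ ^ 2 + ε ^ 2) ((2 : ℝ) • (innerSL ℝ (f x)).comp f') x := by
    have h := hf.norm_sq.add_const (ε ^ 2)
    rwa [← Nat.cast_smul_eq_nsmul ℝ, Nat.cast_ofNat] at h
  have h2 := h1.sqrt hpos.ne'
  refine ⟨_, h2, fun v => ?_⟩
  set S : ℝ := Real.sqrt (‖f x‖ ^ 2 + ε ^ 2) with hS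
  have hSpos : 0 < S := Real.sqrt_pos.2 hpos
  have hfS : ‖f x‖ ≤ S := norm_le_sqrt_norm_sq_add_sq (f x) ε
  have hval : ((1 / (2 * S)) • ((2 : ℝ) • (innerSL ℝ (f x)).comp f')) v = ⟪f x, f' v⟫ / S := by
    show (1 / (2 * S)) * ((2 : ℝ) * ⟪f x, f' v⟫) = ⟪f x, f' v⟫ / S
    field_simp
  rw [hval, norm_div, Real.norm_of_nonneg hSpos.le, div_le_iff₀ hSpos]
  calc ‖⟪f x, f' v⟫‖ ≤ ‖f x‖ * ‖f' v‖ := norm_inner_le_norm _ _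
    _ ≤ S * ‖f' v‖ := mul_le_mul_of_nonneg_right hfS (norm_nonneg _)
    _ = ‖f' v‖ * S := mul_comm _ _

end Regularised

/-! ## The test fields and their derivative bound -/

section TestField

variable {ι : Type*} [Fintype ι]

/-- **Derivative bound for the regularised test fields.** For `C¹` maps `f : E → ℝ^ι`,
`ζ : E → ℝ` with `0 ≤ ζ` and `‖Dζ‖ ≤ L`, and `ε > 0`, the components
`g_i = ⟨f⟩_ε ζ² f_i` satisfy `|∂_v g_i| ≤ (2 ⟨f⟩_ε ζ² ‖Df v‖ + 2 L ⟨f⟩_ε ‖f‖ ζ ‖v‖)`. [folklore] -/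
theorem norm_fderiv_weightedComponent_le {E : Type*} [NormedAddCommGroup E] [NormedSpace ℝ E]
    {f : E → EuclideanSpace ℝ ι} {ζ : E → ℝ} (hf : Differentiable ℝ f) (hζ : Differentiable ℝ ζ)
    (hζ0 : ∀ x, 0 ≤ ζ x) {L : ℝ} (hL : ∀ x, ‖fderiv ℝ ζ x‖ ≤ L) {ε : ℝ} (hε : 0 < ε) (i : ι)
    (x v : E) :
    ‖fderiv ℝ (fun x => Real.sqrt (‖f x‖ ^ 2 + ε ^ 2) * ζ x ^ 2 * f x i) x v‖ ≤
      2 * Real.sqrt (‖f x‖ ^ 2 + ε ^ 2) * ζ x ^ 2 * ‖fderiv ℝ f x v‖ +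
        2 * L * Real.sqrt (‖f x‖ ^ 2 + ε ^ 2) * ‖f x‖ * ζ x * ‖v‖ := by
  obtain ⟨D, hD, hDle⟩ := hasFDerivAt_sqrt_norm_sq_add_sq (hf x).hasFDerivAt hε
  set q : E → ℝ := fun x => Real.sqrt (‖f x‖ ^ 2 + ε ^ 2) with hq
  have hqx : ‖f x‖ ≤ q x := norm_le_sqrt_norm_sq_add_sq (f x) ε
  have hq0 : 0 ≤ q x := Real.sqrt_nonneg _
  -- the three factors
  have hζ2 : HasFDerivAt (fun x => ζ x ^ 2) ((2 * ζ x) • fderiv ℝ ζ x) x := by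
    have := ((hζ x).hasFDerivAt).pow 2
    simpa using this
  have hfi : HasFDerivAt (fun x => f x i)
      ((EuclideanSpace.proj i : EuclideanSpace ℝ ι →L[ℝ] ℝ).comp (fderiv ℝ f x)) x := by
    have h := (EuclideanSpace.proj (𝕜 := ℝ) i).hasFDerivAt.comp x (hf x).hasFDerivAt
    exact h
  have hprod := (hD.mul hζ2).mul hfi
  have e : (fun x => Real.sqrt (‖f x‖ ^ 2 + ε ^ 2) * ζ x ^ 2 * f x i) =
      ((q * fun x => ζ x ^ 2) * fun x => f x i) := rfl
  rw [e, hprod.fderiv]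
  -- evaluate at `v`
  have hDv : ‖D v‖ ≤ ‖fderiv ℝ f x v‖ := hDle v
  have hζv : ‖fderiv ℝ ζ x v‖ ≤ L * ‖v‖ :=
    (ContinuousLinearMap.le_opNorm _ _).trans (mul_le_mul_of_nonneg_right (hL x) (norm_nonneg _))
  have hfiv : ‖((EuclideanSpace.proj i : EuclideanSpace ℝ ι →L[ℝ] ℝ).comp (fderiv ℝ f x)) v‖ ≤
      ‖fderiv ℝ f x v‖ := by
    rw [ContinuousLinearMap.comp_apply]
    exact PiLp.norm_apply_le (fderiv ℝ f x v) i
  have hfix : ‖f x i‖ ≤ ‖f x‖ := PiLp.norm_apply_le (f x) i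
  have hL0 : 0 ≤ L := (norm_nonneg _).trans (hL x)
  -- the value of the derivative
  simp only [FunLike.coe_add, Pi.add_apply, FunLike.coe_smul,
    Pi.smul_apply, smul_eq_mul, ContinuousLinearMap.coe_comp, Function.comp_apply, Pi.mul_apply]
  have h2ζ : (0 : ℝ) ≤ 2 * ζ x := by linarith [hζ0 x]
  have hA : ‖q x * ζ x ^ 2 * (EuclideanSpace.proj i : EuclideanSpace ℝ ι →L[ℝ] ℝ) (fderiv ℝ f x v)‖ ≤
      q x * ζ x ^ 2 * ‖fderiv ℝ f x v‖ := by
    rw [norm_mul, norm_mul, Real.norm_of_nonneg hq0, Real.norm_of_nonneg (sq_nonneg _)]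
    exact mul_le_mul_of_nonneg_left hfiv (by positivity)
  have hB1 : ‖q x * (2 * ζ x * fderiv ℝ ζ x v)‖ ≤ q x * (2 * ζ x * (L * ‖v‖)) := by
    rw [norm_mul, norm_mul, Real.norm_of_nonneg hq0, Real.norm_of_nonneg h2ζ]
    gcongr
  have hB2 : ‖ζ x ^ 2 * D v‖ ≤ ζ x ^ 2 * ‖fderiv ℝ f x v‖ := by
    rw [norm_mul, Real.norm_of_nonneg (sq_nonneg _)]
    gcongr
  have hB : ‖f x i * (q x * (2 * ζ x * fderiv ℝ ζ x v) + ζ x ^ 2 * D v)‖ ≤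
      ‖f x‖ * (q x * (2 * ζ x * (L * ‖v‖)) + ζ x ^ 2 * ‖fderiv ℝ f x v‖) := by
    rw [norm_mul]
    exact mul_le_mul hfix ((norm_add_le _ _).trans (add_le_add hB1 hB2)) (norm_nonneg _)
      (norm_nonneg _)
  have h1 : ‖f x‖ * (ζ x ^ 2 * ‖fderiv ℝ f x v‖) ≤ q x * ζ x ^ 2 * ‖fderiv ℝ f x v‖ := by
    rw [← mul_assoc]
    gcongr
  calc _ ≤ ‖q x * ζ x ^ 2 * (EuclideanSpace.proj i : EuclideanSpace ℝ ι →L[ℝ] ℝ) (fderiv ℝ f x v)‖ +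
        ‖f x i * (q x * (2 * ζ x * fderiv ℝ ζ x v) + ζ x ^ 2 * D v)‖ := norm_add_le _ _
    _ ≤ q x * ζ x ^ 2 * ‖fderiv ℝ f x v‖ +
        ‖f x‖ * (q x * (2 * ζ x * (L * ‖v‖)) + ζ x ^ 2 * ‖fderiv ℝ f x v‖) := add_le_add hA hB
    _ ≤ 2 * q x * ζ x ^ 2 * ‖fderiv ℝ f x v‖ + 2 * L * q x * ‖f x‖ * ζ x * ‖v‖ := by
        nlinarith [h1, hζ0 x, norm_nonneg (f x), norm_nonneg v, hq0,
          mul_nonneg (mul_nonneg hq0 (hζ0 x)) (mul_nonneg hL0 (norm_nonneg v))]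

end TestField

/-! ## The pairing of a represented field with real test functions -/

section Pairing

variable {ι : Type*} [Fintype ι] {E : Type*} [NormedAddCommGroup E] [InnerProductSpace ℝ E]
  [FiniteDimensional ℝ E] [MeasurableSpace E] [BorelSpace E]

/-- **Components of the pairing with a real test function**: for the distribution `U` of a field
`f : E → ℝ^ι` and a real smooth compactly supported `θ`, `Re ⟨U, θ⟩_i = ∫ θ f_i`.
[folklore] -/
theorem IsDistributionOf.re_apply_apply_eq_integral {f : E → EuclideanSpace ℝ ι}
    {U : 𝓢'(E, EuclideanSpace ℂ ι)} (hU : IsDistributionOf f U) {θ : E → ℝ}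
    (hθ : ContDiff ℝ ((⊤ : ℕ∞) : WithTop ℕ∞) θ) (hθc : HasCompactSupport θ) (i : ι) :
    ((U ((hθc.comp_left Complex.ofReal_zero).toSchwartzMap
        (Complex.ofRealCLM.contDiff.comp hθ))) i).re = ∫ x, θ x * f x i := by
  set Θ : 𝓢(E, ℂ) := (hθc.comp_left Complex.ofReal_zero).toSchwartzMap
    (Complex.ofRealCLM.contDiff.comp hθ) with hΘ
  have hΘapply : ∀ x, Θ x = ((θ x : ℝ) : ℂ) := fun x => rfl
  have h := (hU.proj i Θ).2
  have h' : (U Θ) i = ∫ x, Θ x * (f x i : ℂ) := h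
  rw [h']
  simp_rw [hΘapply, ← Complex.ofReal_mul]
  rw [integral_complex_ofReal, Complex.ofReal_re]

end Pairing

/-! ## The slice estimate -/

section Slice

/-- The conjugate exponent bookkeeping: for `6 ≤ p < ∞`, `p' = p/(p-1)` satisfies `1 < p' ≤ 6/5`
and `1/p' = 1 - 1/p`. [folklore] -/
theorem conj_exponent_facts {ρ : ℝ} (hρ : 6 ≤ ρ) :
    1 < ρ / (ρ - 1) ∧ ρ / (ρ - 1) ≤ 6 / 5 ∧ 1 / (ρ / (ρ - 1)) = 1 - 1 / ρ := by
  have h1 : 0 < ρ - 1 := by linarith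
  refine ⟨?_, ?_, ?_⟩
  · rw [lt_div_iff₀ h1]; linarith
  · rw [div_le_iff₀ h1]; linarith
  · field_simp

set_option maxHeartbeats 3200000 in
/-- **The local `L³` estimate of a smooth field through its critical Besov norm — slice form**
(Wang–Zhang 2017, Lemma 4.1, first display, at fixed time; `BMO`-free rendering). For
`6 ≤ p < ∞` there is `K` such that: if `f : ℝ³ → ℝ³` is smooth and represented by the tempered
distribution `U` (realised, `Ṡ_j U → 0`) with `‖U‖_{Ḃ^{-1+3/p}_{p,∞}} ≤ M`, and `ζ` is smooth with
`0 ≤ ζ ≤ 1`, `‖Dζ‖ ≤ L`, supported in the ball `B = B(x₀, R)`, then for every `N ∈ ℤ`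

`∫ |f|³ ζ² ≤ K M (2^N ∫_B |f|² + 2^{-3N/p} |B|^{1/6-1/p} ‖∇f‖_{L²(B)} ‖f‖_{L³(B)}`
`                 + 2^{-3N/p} L |B|^{1/3-1/p} ‖f‖²_{L³(B)})`,

`|∇f|² = frobeniusNormSq (Df)`. Proof in the module docstring.
[cite: WangZhang2016, Lemma 4.1] -/
theorem exists_lintegral_cube_mul_sq_le_of_eHomBesovNorm_le (p : ℝ≥0∞) [Fact (1 ≤ p)]
    (hp6 : 6 ≤ p) (hp : p ≠ ⊤) :
    ∃ K : ℝ≥0, ∀ (f : EuclideanSpace ℝ (Fin 3) → EuclideanSpace ℝ (Fin 3))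
      (U : 𝓢'(EuclideanSpace ℝ (Fin 3), EuclideanSpace ℂ (Fin 3))) (M : ℝ≥0)
      (ζ : EuclideanSpace ℝ (Fin 3) → ℝ) (x₀ : EuclideanSpace ℝ (Fin 3)) (R L : ℝ) (N : ℤ),
      ContDiff ℝ ((⊤ : ℕ∞) : WithTop ℕ∞) f → IsDistributionOf f U →
      Tendsto (fun j : ℤ => FunctionSpaces.lowFreqCutoff j U) atBot (𝓝 0) →
      FunctionSpaces.eHomBesovNorm (-1 + 3 / p.toReal) p ∞ U ≤ M →
      ContDiff ℝ ((⊤ : ℕ∞) : WithTop ℕ∞) ζ → tsupport ζ ⊆ ball x₀ R → (∀ x, 0 ≤ ζ x) →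
      (∀ x, ζ x ≤ 1) → (∀ x, ‖fderiv ℝ ζ x‖ ≤ L) → 0 < R →
      ∫⁻ x, ‖f x‖ₑ ^ (3 : ℕ) * ENNReal.ofReal (ζ x ^ 2) ≤
        K * M * ((2 : ℝ≥0∞) ^ (N : ℝ) * (∫⁻ x in ball x₀ R, ‖f x‖ₑ ^ 2) +
          (2 : ℝ≥0∞) ^ (-(3 * (N : ℝ) / p.toReal)) *
            volume (ball x₀ R) ^ (1 / 6 - 1 / p.toReal) *
            (∫⁻ x in ball x₀ R, ENNReal.ofReal (frobeniusNormSq (fderiv ℝ f x))) ^ (1 / 2 : ℝ) *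
            (∫⁻ x in ball x₀ R, ‖f x‖ₑ ^ (3 : ℕ)) ^ (1 / 3 : ℝ) +
          (2 : ℝ≥0∞) ^ (-(3 * (N : ℝ) / p.toReal)) * ENNReal.ofReal L *
            volume (ball x₀ R) ^ (1 / 3 - 1 / p.toReal) *
            (∫⁻ x in ball x₀ R, ‖f x‖ₑ ^ (3 : ℕ)) ^ (2 / 3 : ℝ)) := by
  classical
  -- ### exponents
  set ρ : ℝ := p.toReal with hρ
  have hρ6 : 6 ≤ ρ := by
    have h := ENNReal.toReal_mono hp hp6
    simpa using h
  have hρpos : 0 < ρ := by linarith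
  obtain ⟨hρ'1, hρ'65, hρ'inv⟩ := conj_exponent_facts hρ6
  set ρ' : ℝ := ρ / (ρ - 1) with hρ'
  have hρ'pos : 0 < ρ' := by linarith
  have hpρ : p = ENNReal.ofReal ρ := (ENNReal.ofReal_toReal hp).symm
  set p' : ℝ≥0∞ := ENNReal.ofReal ρ' with hp'
  have hp'top : p' ≠ ⊤ := ENNReal.ofReal_ne_top
  have hp'toReal : p'.toReal = ρ' := ENNReal.toReal_ofReal hρ'pos.le
  haveI hHC : ENNReal.HolderConjugate p' p := by
    have h : ρ'.HolderConjugate ρ :=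
      (Real.HolderConjugate.conjExponent (by linarith : (1 : ℝ) < ρ)).symm
    have h' := h.ennrealOfReal
    rwa [← hpρ] at h'
  set s : ℝ := -1 + 3 / ρ with hsdef
  have hs : -1 < s := by
    have h3 : 0 < 3 / ρ := by positivity
    rw [hsdef]
    linarith
  have h1s : 1 + s = 3 / ρ := by rw [hsdef]; ring
  -- ### the constants
  obtain ⟨C_V, hCV⟩ := exists_sub_lowFreqCutoff_eq_sum_lineDeriv_of_eHomBesovNorm
    (E := EuclideanSpace ℝ (Fin 3)) (F := EuclideanSpace ℂ (Fin 3)) p hs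
    (EuclideanSpace.basisFun (Fin 3) ℝ)
  obtain ⟨C_E, hCE⟩ := FunctionSpaces.besov_embedding_holds (E := EuclideanSpace ℝ (Fin 3))
    (F := EuclideanSpace ℂ (Fin 3)) s (p := p) (r := ⊤) le_top ∞
  have hexp : s - (Module.finrank ℝ (EuclideanSpace ℝ (Fin 3)) : ℝ) *
      (p.toReal⁻¹ - (⊤ : ℝ≥0∞).toReal⁻¹) = -1 := by
    rw [finrank_euclideanSpace_fin, ENNReal.toReal_top, inv_zero, sub_zero, hsdef, ← hρ]
    field_simp
    ring
  set M₀ : ℝ≥0∞ := FunctionSpaces.lowFreqOpNormBound (EuclideanSpace ℝ (Fin 3)) with hM₀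
  have hM₀top : M₀ ≠ ⊤ := FunctionSpaces.lowFreqOpNormBound_lt_top.ne
  have hhalf : (1 - (2 : ℝ≥0∞) ^ (-1 : ℝ))⁻¹ ≠ ⊤ :=
    ENNReal.inv_ne_top.2 (FunctionSpaces.one_sub_two_rpow_ne_zero (by norm_num))
  set K₁ : ℝ≥0∞ := 2 * M₀ * (1 - (2 : ℝ≥0∞) ^ (-1 : ℝ))⁻¹ * 2 * C_E with hK₁
  have hK₁top : K₁ ≠ ⊤ := by
    rw [hK₁]
    exact ENNReal.mul_ne_top (ENNReal.mul_ne_top (ENNReal.mul_ne_top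
      (ENNReal.mul_ne_top (by simp) hM₀top) hhalf) (by simp)) ENNReal.coe_ne_top
  refine ⟨3 * K₁.toNNReal + 18 * C_V, ?_⟩
  intro f U M ζ x₀ R L N hf hU hreal hM hζ hζsupp hζ0 hζ1 hζL hR
  -- ### notation and elementary facts
  set b : OrthonormalBasis (Fin 3) ℝ (EuclideanSpace ℝ (Fin 3)) := EuclideanSpace.basisFun (Fin 3) ℝ
    with hb
  set B : Set (EuclideanSpace ℝ (Fin 3)) := ball x₀ R with hB
  set μB : Measure (EuclideanSpace ℝ (Fin 3)) := volume.restrict B with hμB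
  haveI : IsFiniteMeasure μB := by
    rw [hμB, hB]; exact isFiniteMeasure_restrict.2 measure_ball_lt_top.ne
  have hμBuniv : μB univ = volume B := by rw [hμB, Measure.restrict_apply_univ]
  have hL0 : 0 ≤ L := (norm_nonneg _).trans (hζL x₀)
  have hζzero : ∀ x, x ∉ B → ζ x = 0 := fun x hx =>
    image_eq_zero_of_notMem_tsupport fun h => hx (hζsupp h)
  have hζc : HasCompactSupport ζ :=
    IsCompact.of_isClosed_subset (isCompact_closedBall x₀ R) (isClosed_tsupport ζ)
      (hζsupp.trans ball_subset_closedBall)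
  have hfc : Continuous f := hf.continuous
  have hfd : Differentiable ℝ f := hf.differentiable (by simp)
  have hζd : Differentiable ℝ ζ := hζ.differentiable (by simp)
  -- the gradient modulus `𝒟 = |∇f|`
  set 𝒟 : EuclideanSpace ℝ (Fin 3) → ℝ := fun x => Real.sqrt (frobeniusNormSq (fderiv ℝ f x))
    with h𝒟
  have h𝒟0 : ∀ x, 0 ≤ 𝒟 x := fun x => Real.sqrt_nonneg _
  have h𝒟c : Continuous 𝒟 := by
    refine Real.continuous_sqrt.comp ?_
    have hcont : Continuous fun x => fderiv ℝ f x := hf.continuous_fderiv (by simp)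
    simp only [frobeniusNormSq]
    fun_prop
  have hDf_le : ∀ x k, ‖fderiv ℝ f x (b k)‖ ≤ 𝒟 x := by
    intro x k
    rw [h𝒟]
    dsimp only
    rw [frobeniusNormSq_eq_sum b, Real.le_sqrt (norm_nonneg _) (Finset.sum_nonneg fun _ _ => sq_nonneg _)]
    exact Finset.single_le_sum (f := fun i => ‖fderiv ℝ f x (b i)‖ ^ 2) (fun _ _ => sq_nonneg _)
      (Finset.mem_univ k)
  -- ### the Besov data: `U = Ṡ_N U + ∑_k ∂_k V_k`
  have hMtop : FunctionSpaces.eHomBesovNorm s p ∞ U ≠ ⊤ := ne_top_of_le_ne_top ENNReal.coe_ne_top hM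
  obtain ⟨V, hVsum, hVle⟩ := hCV N U hMtop
  have hVk : ∀ k, FunctionSpaces.eLpNormDistrib p (V k) ≤
      C_V * (2 : ℝ≥0∞) ^ (-(3 * (N : ℝ) / p.toReal)) * M := by
    intro k
    refine (hVle k).trans ?_
    rw [h1s, ← hρ]
    have e : -((N : ℝ) * (3 / ρ)) = -(3 * (N : ℝ) / ρ) := by ring
    rw [e]
    gcongr
  have h2top : (2 : ℝ≥0∞) ^ (-(3 * (N : ℝ) / p.toReal)) ≠ ⊤ :=
    ENNReal.rpow_ne_top_of_ne_zero two_ne_zero ENNReal.ofNat_ne_top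
  have hVlt : ∀ k, FunctionSpaces.eLpNormDistrib p (V k) < ⊤ := fun k =>
    (hVk k).trans_lt (ENNReal.mul_lt_top (ENNReal.mul_lt_top ENNReal.coe_lt_top h2top.lt_top)
      ENNReal.coe_lt_top)
  -- ### the low frequencies: `‖Ṡ_N U‖_{L^∞} ≤ K₁ 2^N M`
  have hSle : FunctionSpaces.eLpNormDistrib ∞ (FunctionSpaces.lowFreqCutoff N U) ≤
      K₁ * (2 : ℝ≥0∞) ^ (N : ℝ) * M := by
    have h1 := FunctionSpaces.eLpNormDistrib_lowFreqCutoff_le_of_neg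
      (E := EuclideanSpace ℝ (Fin 3)) (F := EuclideanSpace ℂ (Fin 3)) (-1) ∞ N hreal
    have h2 : FunctionSpaces.eHomBesovNorm (-1) ∞ ∞ U ≤
        C_E * FunctionSpaces.eHomBesovNorm s p ∞ U := by
      have h := hCE U
      rwa [hexp] at h
    have hpow : (2 : ℝ≥0∞) ^ (-(((N : ℝ) + 1) * (-1))) = 2 ^ (N : ℝ) * 2 := by
      rw [show -(((N : ℝ) + 1) * (-1)) = (N : ℝ) + 1 by ring,
        ENNReal.rpow_add _ _ two_ne_zero ENNReal.ofNat_ne_top, ENNReal.rpow_one]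
    calc FunctionSpaces.eLpNormDistrib ∞ (FunctionSpaces.lowFreqCutoff N U)
        ≤ 2 * M₀ * (1 - (2 : ℝ≥0∞) ^ (-1 : ℝ))⁻¹ * (2 : ℝ≥0∞) ^ (-(((N : ℝ) + 1) * (-1))) *
            FunctionSpaces.eHomBesovNorm (-1) ∞ ∞ U := h1
      _ ≤ 2 * M₀ * (1 - (2 : ℝ≥0∞) ^ (-1 : ℝ))⁻¹ * (2 : ℝ≥0∞) ^ (-(((N : ℝ) + 1) * (-1))) *
            (C_E * M) := by
          gcongr
          exact h2.trans (mul_le_mul' le_rfl hM)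
      _ = K₁ * 2 ^ (N : ℝ) * M := by rw [hpow, hK₁]; ring
  have hSlt : FunctionSpaces.eLpNormDistrib ∞ (FunctionSpaces.lowFreqCutoff N U) < ⊤ :=
    hSle.trans_lt (ENNReal.mul_lt_top (ENNReal.mul_lt_top hK₁top.lt_top
      (ENNReal.rpow_ne_top_of_ne_zero two_ne_zero ENNReal.ofNat_ne_top).lt_top) ENNReal.coe_lt_top)
  -- ### abbreviations for the right-hand side
  set F2 : ℝ≥0∞ := ∫⁻ x in B, ‖f x‖ₑ ^ 2 with hF2
  set F3 : ℝ≥0∞ := ∫⁻ x in B, ‖f x‖ₑ ^ (3 : ℕ) with hF3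
  set DF : ℝ≥0∞ := ∫⁻ x in B, ENNReal.ofReal (frobeniusNormSq (fderiv ℝ f x)) with hDF
  set F1 : ℝ≥0∞ := ∫⁻ x in B, ‖f x‖ₑ with hF1
  set Sinf : ℝ≥0∞ := K₁ * (2 : ℝ≥0∞) ^ (N : ℝ) * M with hSinf
  set SV : ℝ≥0∞ := C_V * (2 : ℝ≥0∞) ^ (-(3 * (N : ℝ) / p.toReal)) * M with hSV
  have hSinftop : Sinf ≠ ⊤ := ENNReal.mul_ne_top (ENNReal.mul_ne_top hK₁top
      (ENNReal.rpow_ne_top_of_ne_zero two_ne_zero ENNReal.ofNat_ne_top)) ENNReal.coe_ne_top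
  have hSVtop : SV ≠ ⊤ := ENNReal.mul_ne_top (ENNReal.mul_ne_top ENNReal.coe_ne_top h2top)
    ENNReal.coe_ne_top
  -- norms on the ball
  have hF3eq : eLpNorm f 3 μB = F3 ^ (1 / 3 : ℝ) := by
    rw [eLpNorm_eq_lintegral_rpow_enorm_toReal (by norm_num) (by norm_num), ENNReal.toReal_ofNat,
      one_div]
    congr 1
    refine lintegral_congr fun x => ?_
    rw [← ENNReal.rpow_natCast]
    norm_num
  have hD2 : ∀ x, ‖𝒟 x‖ₑ ^ (2 : ℝ) = ENNReal.ofReal (frobeniusNormSq (fderiv ℝ f x)) := by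
    intro x
    rw [Real.enorm_eq_ofReal (h𝒟0 x), ENNReal.ofReal_rpow_of_nonneg (h𝒟0 x) (by norm_num)]
    congr 1
    rw [h𝒟]
    dsimp only
    rw [show ((2 : ℝ)) = ((2 : ℕ) : ℝ) by norm_num, Real.rpow_natCast,
      Real.sq_sqrt (frobeniusNormSq_nonneg _)]
  have hDFeq : eLpNorm 𝒟 2 μB = DF ^ (1 / 2 : ℝ) := by
    rw [eLpNorm_eq_lintegral_rpow_enorm_toReal (by norm_num) (by norm_num), ENNReal.toReal_ofNat,
      one_div]
    congr 1
    exact lintegral_congr fun x => hD2 x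
  -- finiteness of the auxiliary norms on the ball
  have hmemLp : ∀ (g : EuclideanSpace ℝ (Fin 3) → ℝ), Continuous g → ∀ r' : ℝ≥0∞,
      eLpNorm g r' μB < ⊤ := by
    intro g hg r'
    obtain ⟨C, hC⟩ := (isCompact_closedBall x₀ R).exists_bound_of_continuousOn hg.continuousOn
    have hbd : ∀ᵐ x ∂μB, ‖g x‖ ≤ C := by
      rw [hμB]
      filter_upwards [ae_restrict_mem measurableSet_ball] with x hx
      exact hC x (ball_subset_closedBall hx)
    have htop : MemLp g ∞ μB := memLp_top_of_bound hg.aestronglyMeasurable C hbd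
    exact (htop.mono_exponent le_top).eLpNorm_lt_top
  have hF1top : F1 ≠ ⊤ := by
    have h := hmemLp (fun x => ‖f x‖) hfc.norm 1
    rw [eLpNorm_one_eq_lintegral_enorm] at h
    have e : F1 = ∫⁻ x, ‖(fun x => ‖f x‖) x‖ₑ ∂μB := by
      rw [hF1, hμB]
      exact lintegral_congr fun x => (enorm_norm (f x)).symm
    rw [e]
    exact h.ne
  -- the `ε`-junk
  set J : ℝ≥0∞ := 3 * Sinf * F1 + 9 * SV * (2 * eLpNorm 𝒟 p' μB +
      2 * ENNReal.ofReal L * eLpNorm (fun x => ‖f x‖) p' μB) with hJ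
  have hJtop : J ≠ ⊤ := by
    rw [hJ]
    refine ENNReal.add_ne_top.2 ⟨ENNReal.mul_ne_top (ENNReal.mul_ne_top (by simp) hSinftop) hF1top,
      ENNReal.mul_ne_top (ENNReal.mul_ne_top (by simp) hSVtop) (ENNReal.add_ne_top.2 ⟨?_, ?_⟩)⟩
    · exact ENNReal.mul_ne_top (by simp) (hmemLp 𝒟 h𝒟c p').ne
    · exact ENNReal.mul_ne_top (ENNReal.mul_ne_top (by simp) ENNReal.ofReal_ne_top)
        (hmemLp _ hfc.norm p').ne
  -- the main quantity
  set T : ℝ≥0∞ := (2 : ℝ≥0∞) ^ (N : ℝ) * F2 +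
      (2 : ℝ≥0∞) ^ (-(3 * (N : ℝ) / p.toReal)) * volume B ^ (1 / 6 - 1 / p.toReal) *
        DF ^ (1 / 2 : ℝ) * F3 ^ (1 / 3 : ℝ) +
      (2 : ℝ≥0∞) ^ (-(3 * (N : ℝ) / p.toReal)) * ENNReal.ofReal L *
        volume B ^ (1 / 3 - 1 / p.toReal) * F3 ^ (2 / 3 : ℝ) with hT
  -- Hölder triples
  haveI hHT1 : ENNReal.HolderTriple 3 2 (ENNReal.ofReal (6 / 5)) := by
    have h : (3 : ℝ).HolderTriple 2 (6 / 5) := ⟨by norm_num, by norm_num, by norm_num⟩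
    have h' := h.ennrealOfReal
    simpa only [ENNReal.ofReal_ofNat] using h'
  haveI hHT2 : ENNReal.HolderTriple 3 3 (ENNReal.ofReal (3 / 2)) := by
    have h : (3 : ℝ).HolderTriple 3 (3 / 2) := ⟨by norm_num, by norm_num, by norm_num⟩
    have h' := h.ennrealOfReal
    simpa only [ENNReal.ofReal_ofNat] using h'
  -- ### the two Hölder estimates on the ball
  have hfn_meas : AEStronglyMeasurable (fun x => ‖f x‖) μB := hfc.norm.aestronglyMeasurable
  have h𝒟_meas : AEStronglyMeasurable 𝒟 μB := h𝒟c.aestronglyMeasurable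
  have hexp1 : 1 / p'.toReal - 1 / (ENNReal.ofReal (6 / 5)).toReal = 1 / 6 - 1 / p.toReal := by
    rw [hp'toReal, ENNReal.toReal_ofReal (by norm_num), hρ'inv, ← hρ]
    ring
  have hexp2 : 1 / p'.toReal - 1 / (ENNReal.ofReal (3 / 2)).toReal = 1 / 3 - 1 / p.toReal := by
    rw [hp'toReal, ENNReal.toReal_ofReal (by norm_num), hρ'inv, ← hρ]
    ring
  have hmain1 : eLpNorm (fun x => ‖f x‖ * 𝒟 x) p' μB ≤
      volume B ^ (1 / 6 - 1 / p.toReal) * DF ^ (1 / 2 : ℝ) * F3 ^ (1 / 3 : ℝ) := by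
    have h65 : p' ≤ ENNReal.ofReal (6 / 5) := ENNReal.ofReal_le_ofReal hρ'65
    have h1 := eLpNorm_le_eLpNorm_mul_rpow_measure_univ h65 (hfn_meas.mul h𝒟_meas)
    have h2 : eLpNorm (fun x => ‖f x‖ * 𝒟 x) (ENNReal.ofReal (6 / 5)) μB ≤
        eLpNorm (fun x => ‖f x‖) 3 μB * eLpNorm 𝒟 2 μB := by
      have h := eLpNorm_smul_le_mul_eLpNorm (p := 3) (q := 2) (r := ENNReal.ofReal (6 / 5))
        (f := 𝒟) (φ := fun x => ‖f x‖) h𝒟_meas hfn_meas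
      exact h
    rw [hexp1, hμBuniv] at h1
    calc eLpNorm (fun x => ‖f x‖ * 𝒟 x) p' μB
        ≤ eLpNorm (fun x => ‖f x‖ * 𝒟 x) (ENNReal.ofReal (6 / 5)) μB *
            volume B ^ (1 / 6 - 1 / p.toReal) := h1
      _ ≤ (eLpNorm (fun x => ‖f x‖) 3 μB * eLpNorm 𝒟 2 μB) *
            volume B ^ (1 / 6 - 1 / p.toReal) := mul_le_mul' h2 le_rfl
      _ = volume B ^ (1 / 6 - 1 / p.toReal) * DF ^ (1 / 2 : ℝ) * F3 ^ (1 / 3 : ℝ) := by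
          rw [eLpNorm_norm, hF3eq, hDFeq]; ring
  have hmain2 : eLpNorm (fun x => ‖f x‖ * ‖f x‖) p' μB ≤
      volume B ^ (1 / 3 - 1 / p.toReal) * F3 ^ (2 / 3 : ℝ) := by
    have h32 : p' ≤ ENNReal.ofReal (3 / 2) := ENNReal.ofReal_le_ofReal (hρ'65.trans (by norm_num))
    have h1 := eLpNorm_le_eLpNorm_mul_rpow_measure_univ h32 (hfn_meas.mul hfn_meas)
    have h2 : eLpNorm (fun x => ‖f x‖ * ‖f x‖) (ENNReal.ofReal (3 / 2)) μB ≤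
        eLpNorm (fun x => ‖f x‖) 3 μB * eLpNorm (fun x => ‖f x‖) 3 μB :=
      eLpNorm_smul_le_mul_eLpNorm (p := 3) (q := 3) (r := ENNReal.ofReal (3 / 2))
        (f := fun x => ‖f x‖) (φ := fun x => ‖f x‖) hfn_meas hfn_meas
    rw [hexp2, hμBuniv] at h1
    have hsq : F3 ^ (1 / 3 : ℝ) * F3 ^ (1 / 3 : ℝ) = F3 ^ (2 / 3 : ℝ) := by
      rw [← ENNReal.rpow_add_of_nonneg _ _ (by norm_num) (by norm_num)]
      norm_num
    calc eLpNorm (fun x => ‖f x‖ * ‖f x‖) p' μB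
        ≤ eLpNorm (fun x => ‖f x‖ * ‖f x‖) (ENNReal.ofReal (3 / 2)) μB *
            volume B ^ (1 / 3 - 1 / p.toReal) := h1
      _ ≤ (eLpNorm (fun x => ‖f x‖) 3 μB * eLpNorm (fun x => ‖f x‖) 3 μB) *
            volume B ^ (1 / 3 - 1 / p.toReal) := mul_le_mul' h2 le_rfl
      _ = volume B ^ (1 / 3 - 1 / p.toReal) * F3 ^ (2 / 3 : ℝ) := by
          rw [eLpNorm_norm, hF3eq, hsq]; ring
  -- ### the `ε`-family of test fields
  have key : ∀ ε : ℝ, 0 < ε →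
      ∫⁻ x, ‖f x‖ₑ ^ (3 : ℕ) * ENNReal.ofReal (ζ x ^ 2) ≤
        (3 * Sinf * F2 + 9 * SV * (2 * (volume B ^ (1 / 6 - 1 / p.toReal) * DF ^ (1 / 2 : ℝ) *
          F3 ^ (1 / 3 : ℝ)) + 2 * ENNReal.ofReal L * (volume B ^ (1 / 3 - 1 / p.toReal) *
          F3 ^ (2 / 3 : ℝ)))) + ENNReal.ofReal ε * J := by
    intro ε hε
    -- the weight `q = ⟨f⟩_ε` and the test fields `g_i = q ζ² f_i`
    set q : EuclideanSpace ℝ (Fin 3) → ℝ := fun x => Real.sqrt (‖f x‖ ^ 2 + ε ^ 2) with hq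
    have hq_f : ∀ x, ‖f x‖ ≤ q x := fun x => norm_le_sqrt_norm_sq_add_sq (f x) ε
    have hq_le : ∀ x, q x ≤ ‖f x‖ + ε := fun x => sqrt_norm_sq_add_sq_le (f x) hε.le
    have hq0 : ∀ x, 0 ≤ q x := fun x => Real.sqrt_nonneg _
    have hqc : ContDiff ℝ ((⊤ : ℕ∞) : WithTop ℕ∞) q := contDiff_sqrt_norm_sq_add_sq hf hε.ne'
    set g : Fin 3 → EuclideanSpace ℝ (Fin 3) → ℝ := fun i x => q x * ζ x ^ 2 * f x i with hg
    have hg_smooth : ∀ i, ContDiff ℝ ((⊤ : ℕ∞) : WithTop ℕ∞) (g i) := fun i =>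
      (hqc.mul (hζ.pow 2)).mul ((EuclideanSpace.proj (𝕜 := ℝ) i).contDiff.comp hf)
    have hg_zero : ∀ i x, x ∉ B → g i x = 0 := fun i x hx => by
      simp only [hg, hζzero x hx]
      ring
    have hg_supp : ∀ i, HasCompactSupport (g i) := by
      intro i
      refine HasCompactSupport.intro (isCompact_closedBall x₀ R) fun x hx => hg_zero i x ?_
      exact fun h => hx (ball_subset_closedBall h)
    set Θ : Fin 3 → 𝓢(EuclideanSpace ℝ (Fin 3), ℂ) := fun i =>
      ((hg_supp i).comp_left Complex.ofReal_zero).toSchwartzMap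
        (Complex.ofRealCLM.contDiff.comp (hg_smooth i)) with hΘ
    have hΘapply : ∀ i x, Θ i x = ((g i x : ℝ) : ℂ) := fun i x => rfl
    -- (1) the pairing identity `∑_i Re ⟨U, Θ_i⟩_i = ∫ q ζ² |f|²`
    have hpair : ∀ i, ((U (Θ i)) i).re = ∫ x, g i x * f x i := fun i =>
      hU.re_apply_apply_eq_integral (hg_smooth i) (hg_supp i) i
    have hint_i : ∀ i, Integrable (fun x => g i x * f x i) := fun i =>
      ((hg_smooth i).continuous.mul
        ((EuclideanSpace.proj (𝕜 := ℝ) i).continuous.comp hfc)).integrable_of_hasCompactSupport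
        (hg_supp i).mul_right
    have hsumint : ∑ i, ∫ x, g i x * f x i = ∫ x, q x * ζ x ^ 2 * ‖f x‖ ^ 2 := by
      rw [← integral_finsetSum _ fun i _ => hint_i i]
      refine integral_congr_ae (Eventually.of_forall fun x => ?_)
      simp only [hg, EuclideanSpace.real_norm_sq_eq, Finset.mul_sum]
      refine Finset.sum_congr rfl fun i _ => ?_
      ring
    -- (2) the decomposition on the test fields
    have hdecomp : ∀ i, U (Θ i) = FunctionSpaces.lowFreqCutoff N U (Θ i) +
        ∑ k, (V k) (-(∂_{b k} (Θ i))) := by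
      intro i
      have hU' : U = FunctionSpaces.lowFreqCutoff N U + ∑ k, ∂_{b k} (V k) := by
        rw [hVsum]; abel
      conv_lhs => rw [hU']
      simp only [FunLike.coe_add, FunLike.coe_sum, Pi.add_apply, Finset.sum_apply]
      rfl
    -- (3) the bounds of the pairings
    have hT1 : ∀ i, ‖FunctionSpaces.lowFreqCutoff N U (Θ i)‖ ≤ (eLpNorm (⇑(Θ i)) 1 volume *
        FunctionSpaces.eLpNormDistrib ∞ (FunctionSpaces.lowFreqCutoff N U)).toReal := fun i =>
      FunctionSpaces.norm_apply_le_of_eLpNormDistrib_lt_top (p := ∞) (q := 1) hSlt (Θ i)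
    have hT2 : ∀ i k, ‖(V k) (-(∂_{b k} (Θ i)))‖ ≤ (eLpNorm (⇑(∂_{b k} (Θ i) : 𝓢(EuclideanSpace ℝ (Fin 3), ℂ))) p' volume *
        FunctionSpaces.eLpNormDistrib p (V k)).toReal := by
      intro i k
      rw [map_neg, norm_neg]
      exact FunctionSpaces.norm_apply_le_of_eLpNormDistrib_lt_top (p := p) (q := p') (hVlt k) _
    -- (4) the real inequality
    have hreal_le : ∫ x, q x * ζ x ^ 2 * ‖f x‖ ^ 2 ≤ ∑ i, ((eLpNorm (⇑(Θ i)) 1 volume *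
        FunctionSpaces.eLpNormDistrib ∞ (FunctionSpaces.lowFreqCutoff N U)).toReal +
        ∑ k, (eLpNorm (⇑(∂_{b k} (Θ i) : 𝓢(EuclideanSpace ℝ (Fin 3), ℂ))) p' volume * FunctionSpaces.eLpNormDistrib p (V k)).toReal) := by
      rw [← hsumint]
      refine Finset.sum_le_sum fun i _ => ?_
      rw [← hpair i, hdecomp i]
      have e : ((FunctionSpaces.lowFreqCutoff N U (Θ i) + ∑ k, (V k) (-(∂_{b k} (Θ i)))) i).re =
          ((FunctionSpaces.lowFreqCutoff N U (Θ i)) i).re + ∑ k, (((V k) (-(∂_{b k} (Θ i)))) i).re := by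
        rw [PiLp.add_apply, Complex.add_re, WithLp.ofLp_sum, Finset.sum_apply, Complex.re_sum]
      rw [e]
      refine add_le_add (((Complex.re_le_norm _).trans (PiLp.norm_apply_le _ i)).trans (hT1 i))
        (Finset.sum_le_sum fun k _ => ?_)
      exact ((Complex.re_le_norm _).trans (PiLp.norm_apply_le _ i)).trans (hT2 i k)
    -- (5) `P₀ ≤ ∫ q ζ² |f|² ≤ ∑_i (‖Θ_i‖₁ ‖Ṡ_N U‖_∞ + ∑_k ‖∂_k Θ_i‖_{p'} ‖V_k‖_p)`
    have hqζf_cont : Continuous fun x => q x * ζ x ^ 2 * ‖f x‖ ^ 2 :=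
      (hqc.continuous.mul (hζ.continuous.pow 2)).mul (hfc.norm.pow 2)
    have hqζf_int : Integrable fun x => q x * ζ x ^ 2 * ‖f x‖ ^ 2 := by
      refine hqζf_cont.integrable_of_hasCompactSupport ?_
      refine HasCompactSupport.intro (isCompact_closedBall x₀ R) fun x hx => ?_
      rw [hζzero x fun h => hx (ball_subset_closedBall h)]
      ring
    have hP0 : ∫⁻ x, ‖f x‖ₑ ^ (3 : ℕ) * ENNReal.ofReal (ζ x ^ 2) ≤
        ENNReal.ofReal (∫ x, q x * ζ x ^ 2 * ‖f x‖ ^ 2) := by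
      rw [ofReal_integral_eq_lintegral_ofReal hqζf_int (Eventually.of_forall fun x => by
        have := hq0 x; positivity)]
      refine lintegral_mono fun x => ?_
      rw [← ofReal_norm, ← ENNReal.ofReal_pow (norm_nonneg _),
        ← ENNReal.ofReal_mul (by positivity)]
      refine ENNReal.ofReal_le_ofReal ?_
      have h1 := hq_f x
      have h2 : 0 ≤ ‖f x‖ ^ 2 * ζ x ^ 2 := by positivity
      nlinarith
    have hstep : ∫⁻ x, ‖f x‖ₑ ^ (3 : ℕ) * ENNReal.ofReal (ζ x ^ 2) ≤
        ∑ i, (eLpNorm (⇑(Θ i)) 1 volume *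
          FunctionSpaces.eLpNormDistrib ∞ (FunctionSpaces.lowFreqCutoff N U) +
          ∑ k, eLpNorm (⇑(∂_{b k} (Θ i) : 𝓢(EuclideanSpace ℝ (Fin 3), ℂ))) p' volume * FunctionSpaces.eLpNormDistrib p (V k)) := by
      refine hP0.trans ((ENNReal.ofReal_le_ofReal hreal_le).trans ?_)
      rw [ENNReal.ofReal_sum_of_nonneg (fun i _ => by positivity)]
      refine Finset.sum_le_sum fun i _ => ?_
      rw [ENNReal.ofReal_add (by positivity) (by positivity),
        ENNReal.ofReal_sum_of_nonneg (fun k _ => by positivity)]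
      exact add_le_add ENNReal.ofReal_toReal_le
        (Finset.sum_le_sum fun k _ => ENNReal.ofReal_toReal_le)
    -- (6) `‖Θ_i‖_{L¹} ≤ ∫_B |f|² + ε ∫_B |f|`
    have hΘ1 : ∀ i, eLpNorm (⇑(Θ i)) 1 volume ≤ F2 + ENNReal.ofReal ε * F1 := by
      intro i
      rw [eLpNorm_one_eq_lintegral_enorm]
      have hsupp : support (fun x => ‖(Θ i) x‖ₑ) ⊆ B := by
        intro x hx
        by_contra hxB
        exact hx (by simp [hΘapply, hg_zero i x hxB])
      rw [← setLIntegral_eq_of_support_subset hsupp]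
      have hF2F1 : F2 + ENNReal.ofReal ε * F1 =
          ∫⁻ x in B, (‖f x‖ₑ ^ 2 + ENNReal.ofReal ε * ‖f x‖ₑ) := by
        rw [hF2, hF1, lintegral_add_left (hfc.measurable.enorm.pow_const 2),
          lintegral_const_mul' _ _ ENNReal.ofReal_ne_top]
      rw [hF2F1]
      refine lintegral_mono fun x => ?_
      rw [hΘapply, ← ofReal_norm, Complex.norm_real, Real.norm_eq_abs, ← ofReal_norm,
        ← ENNReal.ofReal_pow (norm_nonneg _), ← ENNReal.ofReal_mul hε.le,
        ← ENNReal.ofReal_add (by positivity) (by positivity)]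
      refine ENNReal.ofReal_le_ofReal ?_
      simp only [hg]
      rw [abs_mul, abs_mul, abs_of_nonneg (hq0 x), abs_of_nonneg (sq_nonneg _)]
      have h1 : |f x i| ≤ ‖f x‖ := by
        have := PiLp.norm_apply_le (f x) i
        rwa [Real.norm_eq_abs] at this
      have h2 : ζ x ^ 2 ≤ 1 := by
        have := hζ1 x; have := hζ0 x; nlinarith
      calc q x * ζ x ^ 2 * |f x i| ≤ (‖f x‖ + ε) * 1 * ‖f x‖ :=
            mul_le_mul (mul_le_mul (hq_le x) h2 (sq_nonneg _) (by positivity)) h1 (abs_nonneg _)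
              (by positivity)
        _ = ‖f x‖ ^ 2 + ε * ‖f x‖ := by ring
    -- (7) `‖∂_k Θ_i‖_{L^{p'}} ≤ ‖H‖_{L^{p'}(B)}`, `H = 2 q ζ² |∇f| + 2 L q |f| ζ`
    obtain ⟨H, hH⟩ : ∃ H : EuclideanSpace ℝ (Fin 3) → ℝ, H = fun x =>
      2 * q x * ζ x ^ 2 * 𝒟 x + 2 * L * q x * ‖f x‖ * ζ x := ⟨_, rfl⟩
    have hHsupp : support H ⊆ B := by
      intro x hx
      by_contra hxB
      refine hx ?_
      simp only [hH, hζzero x hxB]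
      ring
    have hHc : Continuous H := by
      have := hqc.continuous
      have := hζ.continuous
      simp only [hH]
      fun_prop
    have hdΘ : ∀ i k, eLpNorm (⇑(∂_{b k} (Θ i) : 𝓢(EuclideanSpace ℝ (Fin 3), ℂ))) p' volume ≤ eLpNorm H p' μB := by
      intro i k
      rw [hμB, eLpNorm_restrict_eq_of_support_subset hHsupp]
      refine eLpNorm_mono_real fun x => ?_
      rw [SchwartzMap.lineDerivOp_apply_eq_fderiv]
      have hd : HasFDerivAt (fun x => ((g i x : ℝ) : ℂ)) (Complex.ofRealCLM.comp (fderiv ℝ (g i) x)) x :=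
        Complex.ofRealCLM.hasFDerivAt.comp x
          (((hg_smooth i).differentiable (by simp)) x).hasFDerivAt
      have hfd' : fderiv ℝ (⇑(Θ i)) x = Complex.ofRealCLM.comp (fderiv ℝ (g i) x) := hd.fderiv
      rw [hfd', ContinuousLinearMap.comp_apply, Complex.ofRealCLM_apply, Complex.norm_real]
      refine (norm_fderiv_weightedComponent_le hfd hζd hζ0 hζL hε i x (b k)).trans ?_
      rw [b.orthonormal.1 k, mul_one]
      simp only [hH]
      have h1 := hDf_le x k
      have h2 : 0 ≤ 2 * q x * ζ x ^ 2 := by have := hq0 x; positivity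
      nlinarith [h1, h2]
    -- (8) `‖H‖_{L^{p'}(B)} ≤ 2 (‖ |f| 𝒟‖ + ε ‖𝒟‖) + 2L (‖ |f|² ‖ + ε ‖f‖)` in `L^{p'}(B)`
    have hp'1 : 1 ≤ p' := by
      rw [hp', ← ENNReal.ofReal_one]
      exact ENNReal.ofReal_le_ofReal hρ'1.le
    have hHle : eLpNorm H p' μB ≤
        2 * (eLpNorm (fun x => ‖f x‖ * 𝒟 x) p' μB + ENNReal.ofReal ε * eLpNorm 𝒟 p' μB) +
        2 * ENNReal.ofReal L * (eLpNorm (fun x => ‖f x‖ * ‖f x‖) p' μB +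
          ENNReal.ofReal ε * eLpNorm (fun x => ‖f x‖) p' μB) := by
      -- pointwise: `H ≤ 2 (|f| + ε) 𝒟 + 2 L (|f| + ε) |f|`
      obtain ⟨H₁, hH₁⟩ : ∃ H₁ : EuclideanSpace ℝ (Fin 3) → ℝ, H₁ = fun x => (‖f x‖ + ε) * 𝒟 x :=
        ⟨_, rfl⟩
      obtain ⟨H₂, hH₂⟩ : ∃ H₂ : EuclideanSpace ℝ (Fin 3) → ℝ, H₂ = fun x => (‖f x‖ + ε) * ‖f x‖ :=
        ⟨_, rfl⟩
      have hpt : ∀ x, ‖H x‖ ≤ ((2 : ℝ) • H₁ + (2 * L) • H₂) x := by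
        intro x
        simp only [hH, hH₁, hH₂, Pi.add_apply, Pi.smul_apply, smul_eq_mul]
        have hζx1 := hζ1 x
        have hζx0 := hζ0 x
        have hqx := hq_le x
        have hq0x := hq0 x
        have h𝒟x := h𝒟0 x
        have hfx := norm_nonneg (f x)
        have hζ2 : ζ x ^ 2 ≤ 1 := by nlinarith
        rw [Real.norm_of_nonneg (by positivity)]
        have e1 : 2 * q x * ζ x ^ 2 * 𝒟 x ≤ 2 * ((‖f x‖ + ε) * 𝒟 x) := by
          calc 2 * q x * ζ x ^ 2 * 𝒟 x ≤ 2 * q x * 1 * 𝒟 x := by gcongr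
            _ ≤ 2 * (‖f x‖ + ε) * 1 * 𝒟 x := by gcongr
            _ = 2 * ((‖f x‖ + ε) * 𝒟 x) := by ring
        have e2 : 2 * L * q x * ‖f x‖ * ζ x ≤ 2 * L * ((‖f x‖ + ε) * ‖f x‖) := by
          calc 2 * L * q x * ‖f x‖ * ζ x ≤ 2 * L * q x * ‖f x‖ * 1 := by gcongr
            _ ≤ 2 * L * (‖f x‖ + ε) * ‖f x‖ * 1 := by gcongr
            _ = 2 * L * ((‖f x‖ + ε) * ‖f x‖) := by ring
        linarith
      have hH₁m : AEStronglyMeasurable H₁ μB := by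
        rw [hH₁]; exact (hfn_meas.add aestronglyMeasurable_const).mul h𝒟_meas
      have hH₂m : AEStronglyMeasurable H₂ μB := by
        rw [hH₂]; exact (hfn_meas.add aestronglyMeasurable_const).mul hfn_meas
      have hsplit₁ : eLpNorm H₁ p' μB ≤
          eLpNorm (fun x => ‖f x‖ * 𝒟 x) p' μB + ENNReal.ofReal ε * eLpNorm 𝒟 p' μB := by
        have e : H₁ = (fun x => ‖f x‖ * 𝒟 x) + ε • 𝒟 := by
          funext x; simp only [hH₁, Pi.add_apply, Pi.smul_apply, smul_eq_mul]; ring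
        rw [e]
        refine (eLpNorm_add_le (hfn_meas.mul h𝒟_meas) (h𝒟_meas.const_smul ε) hp'1).trans ?_
        rw [eLpNorm_const_smul, Real.enorm_eq_ofReal hε.le]
        exact le_of_eq rfl
      have hsplit₂ : eLpNorm H₂ p' μB ≤
          eLpNorm (fun x => ‖f x‖ * ‖f x‖) p' μB + ENNReal.ofReal ε * eLpNorm (fun x => ‖f x‖) p' μB := by
        have e : H₂ = (fun x => ‖f x‖ * ‖f x‖) + ε • fun x => ‖f x‖ := by
          funext x; simp only [hH₂, Pi.add_apply, Pi.smul_apply, smul_eq_mul]; ring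
        rw [e]
        refine (eLpNorm_add_le (hfn_meas.mul hfn_meas) (hfn_meas.const_smul ε) hp'1).trans ?_
        rw [eLpNorm_const_smul, Real.enorm_eq_ofReal hε.le]
        exact le_of_eq rfl
      calc eLpNorm H p' μB ≤ eLpNorm ((2 : ℝ) • H₁ + (2 * L) • H₂) p' μB := eLpNorm_mono_real hpt
        _ ≤ eLpNorm ((2 : ℝ) • H₁) p' μB + eLpNorm ((2 * L) • H₂) p' μB :=
            eLpNorm_add_le (hH₁m.const_smul _) (hH₂m.const_smul _) hp'1
        _ = 2 * eLpNorm H₁ p' μB + 2 * ENNReal.ofReal L * eLpNorm H₂ p' μB := by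
            rw [eLpNorm_const_smul, eLpNorm_const_smul, Real.enorm_eq_ofReal (by norm_num),
              Real.enorm_eq_ofReal (by positivity), ENNReal.ofReal_ofNat,
              ENNReal.ofReal_mul (by norm_num), ENNReal.ofReal_ofNat]
        _ ≤ _ := by gcongr
    -- (9) assembling
    have hsum3 : ∀ (c : ℝ≥0∞), ∑ _i : Fin 3, c = 3 * c := fun c => by
      rw [Finset.sum_const, Finset.card_univ, Fintype.card_fin, nsmul_eq_mul, Nat.cast_ofNat]
    calc ∫⁻ x, ‖f x‖ₑ ^ (3 : ℕ) * ENNReal.ofReal (ζ x ^ 2)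
        ≤ ∑ i, (eLpNorm (⇑(Θ i)) 1 volume *
            FunctionSpaces.eLpNormDistrib ∞ (FunctionSpaces.lowFreqCutoff N U) +
            ∑ k, eLpNorm (⇑(∂_{b k} (Θ i) : 𝓢(EuclideanSpace ℝ (Fin 3), ℂ))) p' volume * FunctionSpaces.eLpNormDistrib p (V k)) :=
          hstep
      _ ≤ ∑ _i : Fin 3, ((F2 + ENNReal.ofReal ε * F1) * Sinf + ∑ _k : Fin 3, eLpNorm H p' μB * SV) := by
          refine Finset.sum_le_sum fun i _ => add_le_add (mul_le_mul' (hΘ1 i) hSle)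
            (Finset.sum_le_sum fun k _ => mul_le_mul' (hdΘ i k) (hVk k))
      _ = 3 * ((F2 + ENNReal.ofReal ε * F1) * Sinf) + 9 * (eLpNorm H p' μB * SV) := by
          rw [hsum3, hsum3, mul_add]
          ring
      _ ≤ 3 * ((F2 + ENNReal.ofReal ε * F1) * Sinf) +
          9 * ((2 * (eLpNorm (fun x => ‖f x‖ * 𝒟 x) p' μB + ENNReal.ofReal ε * eLpNorm 𝒟 p' μB) +
            2 * ENNReal.ofReal L * (eLpNorm (fun x => ‖f x‖ * ‖f x‖) p' μB +
              ENNReal.ofReal ε * eLpNorm (fun x => ‖f x‖) p' μB)) * SV) := by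
          gcongr
      _ ≤ 3 * ((F2 + ENNReal.ofReal ε * F1) * Sinf) +
          9 * ((2 * (volume B ^ (1 / 6 - 1 / p.toReal) * DF ^ (1 / 2 : ℝ) * F3 ^ (1 / 3 : ℝ) +
              ENNReal.ofReal ε * eLpNorm 𝒟 p' μB) +
            2 * ENNReal.ofReal L * (volume B ^ (1 / 3 - 1 / p.toReal) * F3 ^ (2 / 3 : ℝ) +
              ENNReal.ofReal ε * eLpNorm (fun x => ‖f x‖) p' μB)) * SV) := by
          gcongr
      _ = (3 * Sinf * F2 + 9 * SV * (2 * (volume B ^ (1 / 6 - 1 / p.toReal) * DF ^ (1 / 2 : ℝ) *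
          F3 ^ (1 / 3 : ℝ)) + 2 * ENNReal.ofReal L * (volume B ^ (1 / 3 - 1 / p.toReal) *
          F3 ^ (2 / 3 : ℝ)))) + ENNReal.ofReal ε * J := by
          rw [hJ]
          ring
  -- ### `ε → 0`
  have hmainle : 3 * Sinf * F2 + 9 * SV * (2 * (volume B ^ (1 / 6 - 1 / p.toReal) * DF ^ (1 / 2 : ℝ) *
      F3 ^ (1 / 3 : ℝ)) + 2 * ENNReal.ofReal L * (volume B ^ (1 / 3 - 1 / p.toReal) *
      F3 ^ (2 / 3 : ℝ))) ≤ ((3 * K₁.toNNReal + 18 * C_V : ℝ≥0) : ℝ≥0∞) * M * T := by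
    have hK₁c : ((K₁.toNNReal : ℝ≥0) : ℝ≥0∞) = K₁ := ENNReal.coe_toNNReal hK₁top
    obtain ⟨K, hK⟩ : ∃ K : ℝ≥0∞, K = ((3 * K₁.toNNReal + 18 * C_V : ℝ≥0) : ℝ≥0∞) := ⟨_, rfl⟩
    rw [← hK]
    have hK3 : 3 * K₁ ≤ K := by
      rw [hK, ENNReal.coe_add, ENNReal.coe_mul, ENNReal.coe_mul, hK₁c]
      push_cast
      exact le_self_add
    have hK18 : 18 * (C_V : ℝ≥0∞) ≤ K := by
      rw [hK, ENNReal.coe_add, ENNReal.coe_mul, ENNReal.coe_mul, hK₁c]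
      push_cast
      exact le_add_self
    obtain ⟨Ta, hTa⟩ : ∃ Ta : ℝ≥0∞, Ta = (2 : ℝ≥0∞) ^ (N : ℝ) * F2 := ⟨_, rfl⟩
    obtain ⟨Tb, hTb⟩ : ∃ Tb : ℝ≥0∞, Tb = (2 : ℝ≥0∞) ^ (-(3 * (N : ℝ) / p.toReal)) *
      volume B ^ (1 / 6 - 1 / p.toReal) * DF ^ (1 / 2 : ℝ) * F3 ^ (1 / 3 : ℝ) := ⟨_, rfl⟩
    obtain ⟨Tc, hTc⟩ : ∃ Tc : ℝ≥0∞, Tc = (2 : ℝ≥0∞) ^ (-(3 * (N : ℝ) / p.toReal)) * ENNReal.ofReal L *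
      volume B ^ (1 / 3 - 1 / p.toReal) * F3 ^ (2 / 3 : ℝ) := ⟨_, rfl⟩
    have hTeq : T = Ta + Tb + Tc := by rw [hT, hTa, hTb, hTc]
    have e1 : 3 * Sinf * F2 = 3 * K₁ * M * Ta := by rw [hSinf, hTa]; ring
    have e2 : 9 * SV * (2 * (volume B ^ (1 / 6 - 1 / p.toReal) * DF ^ (1 / 2 : ℝ) * F3 ^ (1 / 3 : ℝ)) +
        2 * ENNReal.ofReal L * (volume B ^ (1 / 3 - 1 / p.toReal) * F3 ^ (2 / 3 : ℝ))) =
        18 * C_V * M * (Tb + Tc) := by rw [hSV, hTb, hTc]; ring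
    rw [e1, e2, hTeq]
    calc 3 * K₁ * M * Ta + 18 * C_V * M * (Tb + Tc) ≤ K * M * Ta + K * M * (Tb + Tc) := by
          gcongr
      _ = K * M * (Ta + Tb + Tc) := by ring
  refine ENNReal.le_of_forall_pos_le_add fun δ hδ _ => ?_
  -- choose `ε` with `ε J ≤ δ`
  obtain ⟨ε, hε, hεJ⟩ : ∃ ε : ℝ, 0 < ε ∧ ENNReal.ofReal ε * J ≤ δ := by
    refine ⟨(δ : ℝ) / (J.toReal + 1), by positivity, ?_⟩
    calc ENNReal.ofReal ((δ : ℝ) / (J.toReal + 1)) * J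
        = ENNReal.ofReal ((δ : ℝ) / (J.toReal + 1)) * ENNReal.ofReal J.toReal := by
          rw [ENNReal.ofReal_toReal hJtop]
      _ = ENNReal.ofReal ((δ : ℝ) / (J.toReal + 1) * J.toReal) :=
          (ENNReal.ofReal_mul (by positivity)).symm
      _ ≤ ENNReal.ofReal (δ : ℝ) := by
          refine ENNReal.ofReal_le_ofReal ?_
          rw [div_mul_eq_mul_div, div_le_iff₀ (by positivity)]
          nlinarith [ENNReal.toReal_nonneg (a := J), NNReal.coe_nonneg δ]
      _ = δ := ENNReal.ofReal_coe_nnreal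
  calc ∫⁻ x, ‖f x‖ₑ ^ (3 : ℕ) * ENNReal.ofReal (ζ x ^ 2)
      ≤ _ + ENNReal.ofReal ε * J := key ε hε
    _ ≤ ((3 * K₁.toNNReal + 18 * C_V : ℝ≥0) : ℝ≥0∞) * M * T + δ := add_le_add hmainle hεJ

end Slice

end Literature.Analysis.FluidPDE

end
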